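import Summits.MatrixMultiplication.OmegaCensus.STPPCell22Tables
import Summits.MatrixMultiplication.OmegaCensus.STPPVosperTilingWordsPrunedQ
import Summits.MatrixMultiplication.OmegaCensus.STPPKernelBitsets

/-!
# ω-census (abelian STPP census): cell-(2,2) certificate of the fifth leaf `{(2,2,2),(3,3,3)²} @ ℤ₆₁` — stage 3 row function `dead22F`

HONEST FRAMING (pub-omega census; verbatim): lottery ticket; floor = certified bounds/negative ranges.
Census STRUCTURE (seat pub-omega-stpp-1 gen 33, 2026-08-29), family (b2).  KERNEL rows (`decide +kernel`) / glue for the checkers of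
`STPPCell22Checker.lean`; design and python ×1 DATUM in HOME `pub-omega-stpp-1-g33/FIFTH-LEAF.md`, generator `code/gen_cell22_rows.py`.
Nothing here is progress on `ω`.
-/

namespace Summit.MatrixMultiplication.OmegaCensus.CubeNB.S2

open Summit.MatrixMultiplication.OmegaCensus.CubeNB.Bits

/-- The negated cover test of one mask pair `(mY, mZ)` (value lists via `members`; blocks `(3,3,3),(2,2,2)`, enumerator `WQ`, direct orientation). [folklore] -/
def dead22F : ℕ × ℕ → Bool := fun e => !(existsCoverW 61 (members (List.range 61) e.1) (members (List.range 61) e.2) [blockDiffsWQ 61 (members (List.range 61) e.1) (members (List.range 61) e.2) 3 3 3, blockDiffsWQ 61 (members (List.range 61) e.1) (members (List.range 61) e.2) 2 2 2] [] [] [])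

end Summit.MatrixMultiplication.OmegaCensus.CubeNB.S2
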